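import Mathlib
import Summits.Ventures.PercRepro2.SwOutCrossSlab
import Summits.Ventures.PercRepro2.SwOutCrossGenThm

/-!
# The fibre data of two dropped vertices with a cross edge (blind cell PercRepro2, night-4 g23,
2026-08-28; proofs/NIGHT4-G23.md §8)

The fibre `Fib` of `SwOutCrossDefs` with its atoms `p₁, p₂, cross`, its leak, core points, labels,
slab injection `Fib.psi` and the core pairs `a ↔ f`, `b ↔ d` is a `FibreData` (`fibK2`); every
finite fact is checked by `decide`.  **`card_le_crossK2`** is the generic theorem on it.
-/

namespace Summit.Ventures.PercRepro2

namespace CrossArm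

open scoped Classical

/-- The fibre atoms of two dropped vertices with a cross edge. -/
inductive AtomP where
  /-- the first dropped vertex -/
  | p₁ : AtomP
  /-- the second dropped vertex -/
  | p₂ : AtomP
  /-- the cross edge -/
  | cross : AtomP
  deriving DecidableEq, Fintype

/-- The red fibre atoms of a point: the attachment data. -/
def Fib.red (w : Fib) : AtomP → Bool
  | AtomP.p₁ => w.att₁
  | AtomP.p₂ => w.att₂
  | AtomP.cross => w.attC

/-- The fibre data of two dropped vertices with a cross edge. -/
def fibK2 : FibreData Fib AtomP Label where
  flip := Fib.flip
  flip_flip := Fib.flip_flip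
  red := Fib.red
  leakR := Fib.LeakR
  core := Fib.Core
  label := Fib.label
  BetterL := Label.Better
  betterL_refl := Label.Better_refl
  psi := Fib.psi
  core_of_noLeak := Fib.core_of_noLeak
  leakR_core := Fib.leakR_eq_false_of_core
  leakR_flip_core := Fib.leakB_eq_false_of_core
  core_flip := by decide
  psi_ok := by decide
  psi_inj := Fib.psi_inj
  core0 := {wa, wb}
  core0_core := by decide
  core_cases := by decide
  flip_core0 := by decide
  pair_label := by decide
  pair_red := by decide

/-- **The abstract theorem of boundary (iv) for two dropped vertices with a cross edge**, from the
generic theorem. -/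
theorem card_le_crossK2 {ι : Type*} [Fintype ι] [DecidableEq ι] [Nonempty ι]
    {𝒯 : Set (TypG Label ι)} (h𝒯 : IsUpG fibK2 𝒯) {𝓔 : Set (Set (AtomG AtomP ι))}
    (h𝓔 : IsUpperSet 𝓔) :
    ((QG fibK2 𝒯).filter fun q => ERG fibK2 q ∈ 𝓔).card ≤
      ((QG fibK2 𝒯).filter fun q => EBG fibK2 q ∈ 𝓔).card :=
  card_le_crossGen h𝒯 h𝓔

end CrossArm

end Summit.Ventures.PercRepro2
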